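import Summits.BirchSwinnertonDyer.Rank1Residual.Additive.StrictSignedPreimageFiniteRankOne
import Summits.BirchSwinnertonDyer.Rank1Residual.Additive.CofinalLineOfBoundedTorsionGrowth
import Summits.BirchSwinnertonDyer.Rank1Residual.Additive.KummerLevelClassBridge
import Summits.BirchSwinnertonDyer.Rank1Residual.Additive.SelmerInftyPreimageTorsionCount
import Summits.BirchSwinnertonDyer.Rank1Residual.Additive.DefectCountSignedTwistAssembly
import Summits.BirchSwinnertonDyer.Rank1Residual.Additive.DefectCountLevelInputs
import Summits.BirchSwinnertonDyer.Rank1Residual.Additive.TowerStructureLocalIndex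
import Summits.BirchSwinnertonDyer.Rank1Residual.Additive.StrictSelmerIndex
import Summits.BirchSwinnertonDyer.Rank1Residual.Additive.StrictSignedSelmerLayerZero
import Summits.BirchSwinnertonDyer.Rank1Residual.Additive.RankOneKummerInputs
import Literature.NumberTheory.EllipticCurves.SelmerCorankControlRatProofs
import HarnessLib

/-!
# **`X^{−,str}(W/ℚ_∞)` IS `Λ`-TORSION WITH `f(0) ≠ 0` IN RANK ONE — (hMW) DISCHARGED** from the
# finite-level Poitou–Tate count: the dual-datum inputs `[Module.Finite]`, `hX`, `h0` of the (C3_η)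
# Selmer side (file 108) are THEOREMS given `hPT`, `Ш(W)[p^∞]` finite and the rank-one inputs
# (cell `b2b-bsdres`, CLASS-CLOSURE lane, class O10 — x1b GEN 43, class lead; file 118 of the series:
# Step 3 of `HMW-COUNT-PLAN`, files 114 + 115 + 116 + 117 composed)

HONEST FRAMING (cell `b2b-bsdres`, run/shared/lean/b2b/bsd-rank1-residual/, verbatim in every
file): the goal of the cell is to DELETE the COMBINATION-SHAPED residual classes of the
Birch–Swinnerton-Dyer formula for ALL analytic-rank `≤ 1` elliptic curves over `ℚ` — "full BSD
formula for every rank `≤ 1` curve in class `C`" assembled STRICTLY from published theorems — so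
that the rank-`≤ 1` remainder becomes exactly the CONSTRUCTION-SHAPED classes, which are TYPED
(missing-input `Prop`s), NOT attempted. This is not "finishing BSD". CLASS-CLOSURE lane: prove
what is provable now; shrink each hard class to its core with data; no claim beyond stated classes;
research routes on CONSTRUCTION-SHAPED X12 / O10; census / instrument output = EVIDENCE / conjecture
items, NEVER a Literature fact; `RESIDUAL-MAP.md` marks change only by signed lines. THIS FILE:
TOOL THEOREMS ONLY — no definition, no named Literature fact, no Summits-side fact `def … : Prop`,
no `sorry`, axioms standard; CONDITIONAL (hypothesis `hPT`) on the NAMED FACT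
`poitouTate_selmerStructure_duality_real ℚ` exactly as files 107, 108, 117, and on the INPUTS
displayed below (`Ш(W)[p^∞]` finite — in the application Gross–Zagier–Kolyvagin; a generator modulo
torsion of exact level `ν`); nothing is booked; no label / mark / count / sub-cell moves; nothing about
(C1_η), (C2_η-GZ), (C3_η) as typed, or `BSD(W, p)` of any pair, is claimed.

## What

For the `(−1)^{p/2}p`-twist `W` of a globally minimal `V/ℚ` with good reduction at the odd prime `p`,
`a_p(V) = 0`, `κ` the cyclotomic `ℤ_p`-extension with topological generator `γ`, given: the named fact
`hPT`; `P ∈ W(ℚ)` of infinite order generating `W(ℚ)` modulo torsion, of exact level `ν` in `W(ℚ_p)`;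
`Ш(W)[p^∞]` finite; any finite set `T ∌ (p)` of places containing every `ℓ ≠ p` with `p ∣ c_ℓ(W)`:
* `exists_mordellWeil_cofinal_of_quadraticTwist_signedPrime` — **(hMW) HOLDS**: `∃ t, ∀ y ∈ A₀ =
  Sel^{loc,∞}(W/ℚ), ∃ m ≥ ν, a, p^t·y = a·Φ(κ_m(P))`: file 117 (the count `#R_∞[p^k] ≤ C·p^k`,
  `R_∞ = h₀⁻¹(Sel_∞) ⊇ A₀`, with `S₀` finite from `#S₀ = #Sel_str = p^ν·#Ш[p^∞]`, gen 30) + file 116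
  (the compatible system `x_m = Φ(κ_m(P))` of orders `p^m`) + file 115 (the algebra);
* **`finite_localPreimage_of_quadraticTwist_signedPrime_rankOne`** — `A₀` is FINITE (file 114);
* **`isTorsion_and_constantCoeff_ne_zero_of_quadraticTwist_signedPrime_rankOne`** — for EVERY strict-minus
  dual datum `D`: `X` finitely generated, `Λ`-TORSION, and every characteristic generator `f` has
  `ord_T f = 0`, `f(0) ≠ 0` (file 114 + file 110).
So on the Selmer side of (C3_η) (file 108 `card_sha_mul_eq_pow_of_quadraticTwist_signedPrime_rankOne`)
the inputs `[Module.Finite Λ X]`, `hX`, `h0` are DISCHARGED given `hPT` + `Ш(W)[p^∞]` finite + rank one;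
`hnf` (Kitajima–Otsuki, read on `D`) remains the one dual-datum input.

References: [GreenbergLNM1716] §3 (pp. 85–90), §4 Thm. 4.1, Lemma 4.2; [Kobayashi2003] Thm. 2.2,
Thm. 6.2, Lemma 9.1, Thm. 9.3; [MilneADT2006] I Thm. 4.10; [SilvermanAEC2009] VIII.§2, X.§4.
-/

noncomputable section

open scoped Classical

open CategoryTheory Field Function NumberField IsDedekindDomain WeierstrassCurve
open Literature.NumberTheory.EllipticCurves
open Literature.NumberTheory.GaloisRepresentations
open Literature.NumberTheory.GaloisRepresentations.DiscreteGaloisModule (SelmerStructure)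
open Literature.NumberTheory.GaloisCohomology
open Literature.NumberTheory.EllipticCurves.Kobayashi2003
open Literature.NumberTheory.EllipticCurves.IwasawaAlgebra
open Literature.NumberTheory.EllipticCurves.IwasawaDual
open Summit.BirchSwinnertonDyer.Rank1Residual.X11b.Levels
open Summit.BirchSwinnertonDyer.Rank1Residual.X11b
open scoped ContRepresentation

-- Over `ℚ` two `ℚ`-algebra structures on a completion are in scope; the general-`K` statements must be
-- met by the completion's own (the device of files 78, 107, 108).
attribute [local instance 10000] IsDedekindDomain.HeightOneSpectrum.instAlgebraAdicCompletion
  NumberField.Place.instAlgebraCompletion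

namespace Summit.BirchSwinnertonDyer.Rank1Residual.Additive.LevelBridge

variable (W : WeierstrassCurve ℚ) [W.IsElliptic] {p : ℕ} [hp : Fact p.Prime] (κ : ZpExtension ℚ p)
  [hint : (W.baseChange ℚ_[p]).IsIntegral ℤ_[p]]

section RankOne

variable
    (hp2 : p ≠ 2) (hκ : κ.IsCyclotomic) (Cv : VariableChange ℚ) (V : WeierstrassCurve ℚ)
    [V.IsElliptic] [V.IsGloballyMinimal] (hCV : Cv • W.quadraticTwist ((-1) ^ (p / 2) * p) = V)
    (hgood : V.HasGoodReductionAtPrime p) (hap : V.frobeniusTrace p = 0)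
    (hPT : poitouTate_selmerStructure_duality_real ℚ)
    (P : W.toAffine.Point) (hP : ¬ IsOfFinAddOrder P)
    (hgen : ∀ R : W.toAffine.Point, ∃ (k : ℤ) (T : W.toAffine.Point), IsOfFinAddOrder T ∧ R = k • P + T)
    {ν : ℕ} {Q : (W.baseChange ℚ_[p]).toAffine.Point}
    (hPQ : p ^ ν • Q = Affine.Point.baseChange (W' := W) ℚ ℚ_[p] P)
    (hndiv : ∀ Q' : (W.baseChange ℚ_[p]).toAffine.Point,
      p ^ (ν + 1) • Q' ≠ Affine.Point.baseChange (W' := W) ℚ ℚ_[p] P)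
    [hSha : Finite (AddCommGroup.primaryComponent W.sha p)]
    (T : Finset (HeightOneSpectrum (𝓞 ℚ)))
    (hpT : (Rat.HeightOneSpectrum.primesEquiv (R := 𝓞 ℚ)).symm ⟨p, hp.out⟩ ∉ T)
    (hT : ∀ v : HeightOneSpectrum (𝓞 ℚ), v ≠ (Rat.HeightOneSpectrum.primesEquiv (R := 𝓞 ℚ)).symm ⟨p, hp.out⟩ →
      p ∣ (W.baseChange (v.adicCompletion ℚ)).localTamagawaNumber (v.adicCompletionIntegers ℚ) → v ∈ T)

include hp2 hκ hCV hgood hap hPT hP hgen hPQ hndiv hSha hpT hT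

omit hint in
/-- **(hMW) HOLDS for the `p*`-twist in rank one with `Ш(W)[p^∞]` finite, given `hPT`.** There is `t`
such that every `y ∈ A₀ = Sel^{loc,∞}(W/ℚ)` has `p^t·y = a·Φ(κ_m(P))` for some `m ≥ ν`, `a ∈ ℤ`:
the count `#R_∞[p^k] ≤ C·p^k` of file 117 (`R_∞ = h₀⁻¹(Sel_{p^∞}(W/ℚ_∞)) ⊇ A₀`; `S₀` finite since
`#S₀ = #Sel_str(W/ℚ)[p^∞] = p^ν·#Ш[p^∞]`; `T`-factors finite by B4 for the cyclotomic tower; (Γ), (htors)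
from file 55), the compatible system `x_m = Φ(κ_m(P)) ∈ R_∞` of orders `p^m` (file 116, (MW) at every
level from the generator, file 109) and the algebra of file 115. CONDITIONAL on `hPT`; nothing booked.
[cite: GreenbergLNM1716, §3 (pp. 85–90) and §4 Thm. 4.1] [cite: MilneADT2006, Ch. I, Thm. 4.10]
[cite: SilvermanAEC2009, VIII.§2] -/
theorem exists_mordellWeil_cofinal_of_quadraticTwist_signedPrime :
    ∃ t : ℕ, ∀ y ∈ (W.selmerInfty κ ⊓ ⨅ σ : absoluteGaloisGroup ℚ,
        (localKummerOverOfEmb W p κ.kerSubgroup (closureEmb (K := ℚ) ℚ_[p])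
          (⨆ n, strictSignedLocalPoints κ ℚ_[p] W (-1) n)).comap
            (W.conjH1 p κ.kerSubgroup σ)).comap (W.layerToInfty κ 0),
      ∃ (m : ℕ) (_ : ν ≤ m) (a : ℤ), p ^ t • y =
        a • resH1Hom (Literature.NumberTheory.EllipticCurves.subgroupIncl (κ.layerSubgroup 0))
          (AddMonoidHom.id (geomPrimaryTorsion W p)) (fun _ _ ↦ rfl)
          (galoisCohomology.map (primaryInclusion W p m) 1
            (kummerMapTorsion W ((p ^ m : ℕ) : ℤ)
              (W.zsmul_geomPoints_surjective_holds
                (show (((p ^ m : ℕ) : ℤ)) ≠ 0 by exact_mod_cast pow_ne_zero m hp.out.ne_zero)) P)) := by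
  set v₀ := (Rat.HeightOneSpectrum.primesEquiv (R := 𝓞 ℚ)).symm ⟨p, hp.out⟩ with hv₀def
  have hpw : ∀ w : HeightOneSpectrum (𝓞 ℚ), w ≠ v₀ → (p : 𝓞 ℚ) ∉ w.asIdeal := fun w hw h ↦
    hw ((natCast_mem_asIdeal_iff_eq_primesEquiv_symm w hp.out).mp h)
  -- the models `ℚ_[p] ⇄ ℚ_{v₀}` (the instance device of file 107)
  obtain ⟨e⟩ : Nonempty (ℚ_[p] ≃A[ℚ] v₀.adicCompletion ℚ) := ⟨Padic.adicCompletionEquiv (𝓞 ℚ) ⟨p, hp.out⟩⟩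
  letI iA₀ : Algebra (v₀.adicCompletion ℚ) ℚ_[p] :=
    ((e.symm : v₀.adicCompletion ℚ ≃A[ℚ] ℚ_[p]) : v₀.adicCompletion ℚ →ₐ[ℚ] ℚ_[p]).toRingHom.toAlgebra
  haveI iT₀ : IsScalarTower ℚ (v₀.adicCompletion ℚ) ℚ_[p] :=
    IsScalarTower.of_algebraMap_eq fun q ↦
      (((e.symm : v₀.adicCompletion ℚ ≃A[ℚ] ℚ_[p]) : v₀.adicCompletion ℚ →ₐ[ℚ] ℚ_[p]).commutes q).symm
  letI iA₀' : Algebra ℚ_[p] (v₀.adicCompletion ℚ) :=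
    ((e : ℚ_[p] ≃A[ℚ] v₀.adicCompletion ℚ) : ℚ_[p] →ₐ[ℚ] v₀.adicCompletion ℚ).toRingHom.toAlgebra
  haveI iT₀' : IsScalarTower ℚ ℚ_[p] (v₀.adicCompletion ℚ) :=
    IsScalarTower.of_algebraMap_eq fun q ↦
      (((e : ℚ_[p] ≃A[ℚ] v₀.adicCompletion ℚ) : ℚ_[p] →ₐ[ℚ] v₀.adicCompletion ℚ).commutes q).symm
  -- (htors) at `ℚ_[p]`, at the embedding, at `ℚ_{v₀}`, in `W(ℚ)`; (Γ) at `ℚ_p` and over `ℚ` (file 55)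
  obtain ⟨M₀, hΔ, hA, hVM₀⟩ := exists_goodSupersingularPadicModel hp2 V hgood hap
  have hc := sq_ne_neg_one_pow_mul_prime hp.out (p / 2)
  have htorsE := eq_zero_of_prime_pow_smul_eq_zero_localFixedPointsOfEmb_kerSubgroup_of_quadraticTwist κ
    (closureEmb (K := ℚ) ℚ_[p]) hp2 W hc Cv hCV M₀ hΔ hA hVM₀
  have htorsX := eq_zero_of_prime_smul_eq_zero_padic_of_quadraticTwist_signedPrime hp2 W Cv hCV M₀ hΔ hA hVM₀
  have htors : ∀ X : (W.baseChange (v₀.adicCompletion ℚ)).toAffine.Point, p • X = 0 → X = 0 := fun X hX ↦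
    eq_zero_of_smul_eq_zero_point_of_localFixedPoints W p (v₀.adicCompletion ℚ) ℚ_[p]
      ((e.symm : v₀.adicCompletion ℚ ≃A[ℚ] ℚ_[p]) : v₀.adicCompletion ℚ →ₐ[ℚ] ℚ_[p]) κ.kerSubgroup htorsE
      (j := 1) X (by rwa [pow_one])
  have htorsQ : ∀ R : W.toAffine.Point, p • R = 0 → R = 0 := fun R hR ↦ by
    have h1 : Affine.Point.map (W' := W) (Algebra.ofId ℚ ℚ_[p]) (p • R) = 0 := by
      rw [hR]; exact map_zero _
    have h2 : p • Affine.Point.map (W' := W) (Algebra.ofId ℚ ℚ_[p]) R = 0 :=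
      (map_nsmul (Affine.Point.map (W' := W) (Algebra.ofId ℚ ℚ_[p])) p R).symm.trans h1
    exact Affine.Point.map_injective (W' := W) (f := Algebra.ofId ℚ ℚ_[p])
      ((htorsX _ h2).trans (map_zero _).symm)
  have hΓE := forall_fixed_eq_zero_of_localFixedPoints W p ℚ_[p] κ.kerSubgroup htorsE
  have hΓ : ∀ Q : W.geomPrimaryTorsion p,
      (∀ σ : absoluteGaloisGroup ℚ, X11b.LocBridge.primaryGaloisModule W p σ Q = Q) → Q = 0 := by
    intro Q hQ
    have hmem : Q ∈ FixedPoints.addSubgroup κ.kerSubgroup (W.geomPrimaryTorsion p) := by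
      rw [FixedPoints.mem_addSubgroup]
      intro σ
      exact hQ σ
    rw [fixedPoints_kerSubgroup_geomPrimaryTorsion_eq_bot_of_quadraticTwist κ hp2 W hc Cv hCV M₀ hΔ hA
      hVM₀] at hmem
    exact (AddSubgroup.mem_bot).mp hmem
  -- `S₀` is finite: `#S₀ = #Sel_str(W/ℚ)[p^∞] = p^ν · #Ш(W)[p^∞] ≠ 0`
  have hidx := StrictSha.strictSelmerIndexAt_holds W p P ν hP hgen htorsX ⟨Q, hPQ⟩ hndiv
  haveI hS₀ : Finite (strictSignedSelmerLayer W κ ℚ_[p] (-1) 0) := by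
    refine Nat.finite_of_card_ne_zero fun hz ↦ ?_
    rw [StrictSignedLayerZero.natCard_strictSignedSelmerLayer_neg_one_zero_eq_strictSelmerPInfty W κ, hidx]
      at hz
    exact mul_ne_zero (pow_ne_zero ν hp.out.ne_zero) Nat.card_pos.ne' hz
  -- the exceptional set: `𝒦_{v,0}[p^∞] = 0` off `T ∪ {v₀}`, finite (`= p^{ord_p c_w}`) on `T`
  have hT0 : ∀ v : HeightOneSpectrum (𝓞 ℚ), v ∉ T → v ≠ v₀ →
      W.localTowerKerPrimary κ (v.adicCompletion ℚ) 0 = ⊥ := fun v hv hne ↦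
    localTowerKerPrimary_eq_bot_of_not_dvd_localTamagawaNumber W hκ (hpw v hne) fun hd ↦ hv (hT v hne hd)
  have hTfin : ∀ w ∈ T, Finite (W.localTowerKerPrimary κ (w.adicCompletion ℚ) 0) := fun w hw ↦ by
    have hne : w ≠ v₀ := fun h ↦ hpT (h ▸ hw)
    obtain ⟨δ, hδ⟩ := Greenberg1999.exists_apply_resGal_ne_one_of_isCyclotomic hκ w
    refine Nat.finite_of_card_ne_zero ?_
    rw [natCard_localTowerKerPrimary_zero_eq_pow_padicValNat_localTamagawaNumber W κ (hpw w hne)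
      ⟨δ, fun h ↦ hδ (ZpExtension.mem_kerSubgroup.mp h)⟩]
    exact pow_ne_zero _ hp.out.ne_zero
  -- THE COUNT (file 117): `#R_∞[p^k] ≤ C · p^k`
  have hcount := fun k ↦ finite_and_ncard_selmerInftyPreimage_torsion_le W κ hPT v₀ rfl htors hΓ hΓE T hpT
    hT0 hTfin k
  -- the compatible system `x_m = Φ(κ_m(P)) ∈ R_∞` of orders `p^m` (files 116, 109, 64)
  have hn0 : ∀ m : ℕ, (((p ^ m : ℕ) : ℤ)) ≠ 0 := fun m ↦ by exact_mod_cast pow_ne_zero m hp.out.ne_zero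
  set Φ := resH1Hom (Literature.NumberTheory.EllipticCurves.subgroupIncl (κ.layerSubgroup 0))
    (AddMonoidHom.id (geomPrimaryTorsion W p)) (fun _ _ ↦ rfl) with hΦ
  set x : ℕ → W.subgroupH1 p (κ.layerSubgroup 0) := fun m ↦
    Φ (galoisCohomology.map (primaryInclusion W p m) 1
      (kummerMapTorsion W ((p ^ m : ℕ) : ℤ) (W.zsmul_geomPoints_surjective_holds (hn0 m)) P)) with hx
  have hxR : ∀ m, x m ∈ W.selmerInftyPreimage κ 0 := fun m ↦
    W.selmerLayer_le_selmerInftyPreimage κ 0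
      ((levelToLayerZero_mem_selmerLayer_zero_iff W p κ m _).mpr
        (RankOneKummerInputs.kummerMapTorsion_mem_selmerGroup_kummerSelmerStructure W _ _ P))
  have hxsucc : ∀ m, p • x (m + 1) = x m := fun m ↦
    (map_nsmul Φ p _).symm.trans
      (congrArg Φ (nsmul_map_primaryInclusion_kummerMapTorsion_succ W p W.zsmul_geomPoints_surjective_holds m P))
  -- (MW) at every level, in the classical `DecidableEq ℚ` of the general-`K` statement of file 116
  have hinst : (instDecidableEqRat : DecidableEq ℚ) = fun a b => Classical.propDecidable (a = b) :=
    Subsingleton.elim _ _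
  have hord : ∀ m, addOrderOf (x m) = p ^ m := fun m ↦ by
    obtain ⟨-, hordm⟩ := rankOne_level_inputs (p := p) hP hgen htorsQ m
    rw [hinst] at hordm
    exact addOrderOf_levelToLayerZero_kummerMapTorsion_eq W p W.zsmul_geomPoints_surjective_holds κ m hΓ P
      hordm
  have hprim : ∀ y ∈ W.selmerInftyPreimage κ 0, ∃ k : ℕ, p ^ k • y = 0 := fun y _ ↦
    W.exists_pow_smul_subgroupH1_layer_eq_zero κ 0 y
  -- file 115: the Mordell–Weil line is cofinal in `R_∞` up to bounded exponent
  obtain ⟨t, ht⟩ := exists_pow_smul_eq_zsmul_of_card_torsion_le x hxR hxsucc hord hprim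
    (fun k ↦ (hcount k).1) (fun k ↦ (hcount k).2)
  -- lift `m ↦ m + ν` along the compatible system
  have hlift : ∀ d m : ℕ, p ^ d • x (m + d) = x m := fun d ↦ by
    induction d with
    | zero => intro m; rw [pow_zero, one_smul, add_zero]
    | succ d ih => intro m; rw [pow_succ, mul_smul, ← add_assoc, hxsucc, ih]
  refine ⟨t, fun y hy ↦ ?_⟩
  have hyR : y ∈ W.selmerInftyPreimage κ 0 :=
    (W.mem_selmerInftyPreimage_iff κ 0 y).mpr (AddSubgroup.mem_inf.mp (AddSubgroup.mem_comap.mp hy)).1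
  obtain ⟨m, a, hya⟩ := ht y hyR
  refine ⟨m + ν, Nat.le_add_left ν m, a * (p ^ ν : ℕ), ?_⟩
  rw [hya, ← hlift ν m, mul_smul, natCast_zsmul]

/-- **`A₀ = Sel^{loc,∞}(W/ℚ)` IS FINITE for the `p*`-twist in rank one** with `Ш(W)[p^∞]` finite, given
`hPT` (file 114 with (hMW) discharged by the previous theorem). CONDITIONAL on `hPT`; nothing booked.
[cite: GreenbergLNM1716, §3 Lemma 3.1–3.3 and §4 Thm. 4.1] [cite: Kobayashi2003, Thm. 9.3 (p. 26)] -/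
theorem finite_localPreimage_of_quadraticTwist_signedPrime_rankOne
    {γ : absoluteGaloisGroup ℚ} (hγ : κ.IsTopGenerator γ) :
    Finite ↥((W.selmerInfty κ ⊓ ⨅ σ : absoluteGaloisGroup ℚ,
        (localKummerOverOfEmb W p κ.kerSubgroup (closureEmb (K := ℚ) ℚ_[p])
          (⨆ n, strictSignedLocalPoints κ ℚ_[p] W (-1) n)).comap
            (W.conjH1 p κ.kerSubgroup σ)).comap (W.layerToInfty κ 0)) := by
  obtain ⟨t, ht⟩ := exists_mordellWeil_cofinal_of_quadraticTwist_signedPrime W κ hp2 hκ Cv V hCV hgood hap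
    hPT P hP hgen hPQ hndiv T hpT hT
  exact finite_localPreimage_of_mordellWeil_cofinal W κ hp2 hκ Cv V hCV hgood hap hγ P hPQ hndiv ht

/-- **`X^{−,str}(W/ℚ_∞)` IS FINITELY GENERATED `Λ`-TORSION WITH `ord_T f = 0`, `f(0) ≠ 0` for EVERY
strict-minus dual datum `D`, for the `p*`-twist in rank one** with `Ш(W)[p^∞]` finite, given `hPT`
(file 114 + file 110, (hMW) discharged). On the Selmer side of (C3_η) (file 108) the inputs
`[Module.Finite Λ X]`, `hX`, `h0` are thereby DISCHARGED; `hnf` remains. CONDITIONAL on `hPT`;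
nothing booked. [cite: GreenbergLNM1716, §1 Thm. 1.4 (p. 60), §4 Lemma 4.2 (p. 102)]
[cite: Kobayashi2003, Thm. 2.2 (p. 5), Thm. 6.2 (p. 11), Thm. 9.3 (p. 26)] -/
theorem isTorsion_and_constantCoeff_ne_zero_of_quadraticTwist_signedPrime_rankOne
    {γ : absoluteGaloisGroup ℚ} (hγ : κ.IsTopGenerator γ) (D : StrictSignedSelmerDualData W κ ℚ_[p] γ (-1)) :
    Module.Finite (IwasawaAlgebra p) D.X ∧ Module.IsTorsion (IwasawaAlgebra p) D.X ∧
      ∀ f : IwasawaAlgebra p, D.charIdeal = Ideal.span {f} →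
        f.order = 0 ∧ PowerSeries.constantCoeff f ≠ 0 := by
  obtain ⟨t, ht⟩ := exists_mordellWeil_cofinal_of_quadraticTwist_signedPrime W κ hp2 hκ Cv V hCV hgood hap
    hPT P hP hgen hPQ hndiv T hpT hT
  exact isTorsion_and_constantCoeff_ne_zero_of_mordellWeil_cofinal W κ hp2 hκ Cv V hCV hgood hap hγ D P hPQ
    hndiv ht

end RankOne

end Summit.BirchSwinnertonDyer.Rank1Residual.Additive.LevelBridge

end
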